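import Summits.QuantumFields.BalabanUV.Beta.GAN24.FaceReadCrossedValueDeep
import Summits.QuantumFields.BalabanUV.Beta.GAN24.ForcingTableRootLetters

/-!
# `BalabanUV.Beta.GAN24.FaceReadCrossedValueRootDeep` — binder row G-an2-4 ∕ (CONV-C), W-slot (α-0), ROW (C) AT LEVELS `≥ 1` (the OWNER's two-index tower, RULING
# R-gan24p1-g40-1; typer's PART VI row T6-VAL, the OWNER's (R-a) at levels `≥ 1`): **ROAD-P2's ADAPTER, VALUE SIDE, LEVELS `≥ 1` — leaf-06 g57's (QD)
# `FaceReadCrossedValueDeep.crossed_faceRead_dressedStep_deep` AT ROAD-P2's ACTUAL ROOT TABLES OF LEVEL `j+1`** — multiplier table `M := unitM sf sm (M1At d Lc ρ_c cΛ (j+1))`,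
# mixed table `M₂ := unitM₂ sf sm (M2Of d Lc (mixFFAt ρ_c Lc) (j+1))` (`ρ_c = toSite r`, `r ∈ box`), every side condition (`hM hMt hSrow hMrow hM₂ hM₂t`) discharged by
# `ForcingTableRootLetters` (the field table's E pins `cE = Lc^{d+1}`, `cVH = −½Lc^{2(d+1)}` are (QD)'s, inside `SpureRecAt`); generic `d`, any `sf sm`, any coarse period
# `P ≥ 1`, any `B` with zero `inl–inl` block (road-P2 chair `b2b-balaban-gan24-p2`, gen 51; journal [GAN24P2-G51-INTENT5])

NOT IN PRINT; OUR BOOKKEEPING ([folklore] instantiation BY NAME, one `exact`; 0 `def`, 0 cited fact, 0 `def … : Prop`, 0 sorry; the displayed statement is (QD)'s with the two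
tables substituted — leaf-06 g57's theorem and credit).  HONEST FRAMING (cell contract, verbatim): «discharging `BetaPertH` makes Bałaban's UV stability UNCONDITIONAL — a real
constructive-QFT result; it is NOT the continuum limit and NOT the Clay problem.»  HONEST DEPENDENCY (verbatim): «continuum YM on T⁴ ⇐ BetaPertH ∧ nine spine estimates (0/9 proved);
BetaPertH ⇐ (D1) ∧ (D4) ∧ CAP+tail; G-an2-4 gates asym, D1 and NE2/3/4.»

WHAT.  **`crossed_faceRead_root_deep (hLc : 1 ≤ Lc) (hr) (hP : 1 ≤ P) (sf sm cΛ) (j) (hBff) (c cB) (hab : a₀ ≠ b₀)`**: for road-P2's literal LEVEL-`(j+1)` E-frame forcing (E pins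
inside the field table) the `LS`-symmetrised coarse-period-`P` face read at the crossed pattern `(a₀,b₀;a₀,b₀)` equals
`4·(c·(−K_{j+1}²))·K_{j+1}²·[E_{j+1}²·(−¼)·sf²·(wVH_{j+1}⁻¹·PAIR_{j+1}(Lc·P) − wVH_{j+1}⁻¹·Lc^{2(d+1)}·PAIR_{j+2}(P))]` summed over the two crossed patterns — (QD) VERBATIM at the root
tables = the `hface` binder of road-P2's END probe 4b at level `k = j` (up to `DepthTowerPrefactors.eePrefactor_closed` and `P (m+1) = Lc·P m`).
READING (zero weight until every link is ✓): with this file the levels-`≥ 1` face line of the crossed VALUE ledger is typed for the ACTUAL tower letters; (QD) itself is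
COMPOSITION-CHECKED by its author over separately certified ingredients (624 KB > the farm's single-request limit).  Asserts NO value of Bałaban's tables beyond (QD)'s displayed
identity; discharges NOTHING of `hX` ∕ `hXu` ∕ (C)_{≥1} ∕ (Q-L) ∕ (H1♮) ∕ (hW, hWall); NEVER «G-an2-4 closed» as (CONV-C); NOT D1, NOT `BetaPertH`, NOT continuum, NOT Clay.
2026-08-24; no existing file touched.
-/

noncomputable section

open Finset
open scoped BigOperators
open Literature.MathematicalPhysics.QuantumFieldTheory
open Literature.MathematicalPhysics.QuantumFieldTheory.Balaban1983to89
open Literature.MathematicalPhysics.QuantumFieldTheory.Balaban1983to89.Beta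
open ExpKernelCalculus (Site MKer shiftK VertexFamily)
open OneStepResolventKernel (Fib)
open OneStepKernelFamily (KInvStep)
open SecondOrderResponse (W2SymOfK LocStencilFM)
open BalabanStepW2 (K3OfK M2Of)
open BalabanStepJetsSucc (mmRead E2 wVH wE)
open AffineAveraging (box toSite)
open AveragingMixedJetTables (mixFFAt)
open Summit.QuantumFields.BalabanUV.Beta.TameKernelCalculus (trK)
open Summit.QuantumFields.BalabanUV.Beta.BorderedHessian (stepScale sgnK)
open Summit.QuantumFields.BalabanUV.Beta.AxialDressingRooted (coDressKBmAt)
open Summit.QuantumFields.BalabanUV.Beta.HessKerDressedUnits (unitK unitS)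
open Summit.QuantumFields.BalabanUV.Beta.SecondOrderUnits (unitM unitM₂)
open Summit.QuantumFields.BalabanUV.Beta.SpineRooted (SpureRecAt M1At)
open Summit.QuantumFields.BalabanUV.Beta.GAN24.BiStencilZeroMode (Tab)
open Summit.QuantumFields.BalabanUV.Beta.GAN24.ForcingTableRootLetters (trK_unitS_SpureRecAt vertexFamily_unitM_M1At unitM_M1At_translate trK_unitM_M1At
  exists_locStencilFM_unitM₂_M2Of unitM₂_M2Of_translate)
open Summit.QuantumFields.BalabanUV.Beta.GAN24.FaceReadCrossedValueDeep (crossed_faceRead_dressedStep_deep)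

namespace Summit.QuantumFields.BalabanUV.Beta.GAN24.FaceReadCrossedValueRootDeep

variable {d : ℕ} {Lc : ℕ} [NeZero Lc] {r : Fin (d + 1) → ℕ}

/-- NOT IN PRINT; OUR BOOKKEEPING.  **(QD) AT THE ROOT TABLES OF LEVEL `j+1`** (module docstring): leaf-06 g57's `crossed_faceRead_dressedStep_deep` with `M := M̃_{j+1}`,
`M₂ := M̃₂_{j+1}` and the six side conditions discharged by `ForcingTableRootLetters`. -/
theorem crossed_faceRead_root_deep (hLc : 1 ≤ Lc) (hr : r ∈ box (d + 1) Lc) {P : ℕ} (hP : 1 ≤ P) (sf sm cΛ : ℝ) (j : ℕ)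
    {B : Tab d} (hBff : ∀ κ u κ' u' x z (α β : Fin (d + 1)), B κ u κ' u' x z (Sum.inl α) (Sum.inl β) = 0) (c cB : ℝ)
    {a₀ b₀ : Fin (d + 1)} (hab : a₀ ≠ b₀) :
        ((fun μ ν α β : Fin (d + 1) => ∑ r' ∈ box (d + 1) P, ∑' u' : Site (d + 1), ∑' x : Site (d + 1), ∑' z : Site (d + 1),
            (if toSite r' μ % (P : ℤ) = (P : ℤ) - 1 ∧ u' ν % (P : ℤ) = (P : ℤ) - 1 ∧ x α % (P : ℤ) = (P : ℤ) - 1 ∧ z β % (P : ℤ) = (P : ℤ) - 1 then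
              (c • mmRead Lc (K3OfK (unitK sf sm (coDressKBmAt (toSite r) Lc (KInvStep (d := d) Lc (j + 1)))) Lc (unitS sf sm (SpureRecAt d Lc (toSite r) ((Lc : ℝ) ^ (d + 1)) (-((Lc : ℝ) ^ (d + 1) * (1 / 2) * (Lc : ℝ) ^ (d + 1))) cΛ (j + 1))) (unitM sf sm (M1At d Lc (toSite r) cΛ (j + 1)))
                  (W2SymOfK (unitK sf sm (coDressKBmAt (toSite r) Lc (KInvStep (d := d) Lc (j + 1)))) Lc (unitS sf sm (SpureRecAt d Lc (toSite r) ((Lc : ℝ) ^ (d + 1)) (-((Lc : ℝ) ^ (d + 1) * (1 / 2) * (Lc : ℝ) ^ (d + 1))) cΛ (j + 1))) (unitM sf sm (M1At d Lc (toSite r) cΛ (j + 1))) 0 (unitM₂ sf sm (M2Of d Lc (mixFFAt (toSite r) Lc) (j + 1)))) μ (toSite r') ν u')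
                + cB • B μ (toSite r') ν u') x z (Sum.inl α) (Sum.inl β) else 0)) a₀ b₀ a₀ b₀
          + (fun μ ν α β : Fin (d + 1) => ∑ r' ∈ box (d + 1) P, ∑' u' : Site (d + 1), ∑' x : Site (d + 1), ∑' z : Site (d + 1),
            (if toSite r' μ % (P : ℤ) = (P : ℤ) - 1 ∧ u' ν % (P : ℤ) = (P : ℤ) - 1 ∧ x α % (P : ℤ) = (P : ℤ) - 1 ∧ z β % (P : ℤ) = (P : ℤ) - 1 then
              (c • mmRead Lc (K3OfK (unitK sf sm (coDressKBmAt (toSite r) Lc (KInvStep (d := d) Lc (j + 1)))) Lc (unitS sf sm (SpureRecAt d Lc (toSite r) ((Lc : ℝ) ^ (d + 1)) (-((Lc : ℝ) ^ (d + 1) * (1 / 2) * (Lc : ℝ) ^ (d + 1))) cΛ (j + 1))) (unitM sf sm (M1At d Lc (toSite r) cΛ (j + 1)))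
                  (W2SymOfK (unitK sf sm (coDressKBmAt (toSite r) Lc (KInvStep (d := d) Lc (j + 1)))) Lc (unitS sf sm (SpureRecAt d Lc (toSite r) ((Lc : ℝ) ^ (d + 1)) (-((Lc : ℝ) ^ (d + 1) * (1 / 2) * (Lc : ℝ) ^ (d + 1))) cΛ (j + 1))) (unitM sf sm (M1At d Lc (toSite r) cΛ (j + 1))) 0 (unitM₂ sf sm (M2Of d Lc (mixFFAt (toSite r) Lc) (j + 1)))) μ (toSite r') ν u')
                + cB • B μ (toSite r') ν u') x z (Sum.inl α) (Sum.inl β) else 0)) b₀ a₀ a₀ b₀)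
        + ((fun μ ν α β : Fin (d + 1) => ∑ r' ∈ box (d + 1) P, ∑' u' : Site (d + 1), ∑' x : Site (d + 1), ∑' z : Site (d + 1),
            (if toSite r' μ % (P : ℤ) = (P : ℤ) - 1 ∧ u' ν % (P : ℤ) = (P : ℤ) - 1 ∧ x α % (P : ℤ) = (P : ℤ) - 1 ∧ z β % (P : ℤ) = (P : ℤ) - 1 then
              (c • mmRead Lc (K3OfK (unitK sf sm (coDressKBmAt (toSite r) Lc (KInvStep (d := d) Lc (j + 1)))) Lc (unitS sf sm (SpureRecAt d Lc (toSite r) ((Lc : ℝ) ^ (d + 1)) (-((Lc : ℝ) ^ (d + 1) * (1 / 2) * (Lc : ℝ) ^ (d + 1))) cΛ (j + 1))) (unitM sf sm (M1At d Lc (toSite r) cΛ (j + 1)))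
                  (W2SymOfK (unitK sf sm (coDressKBmAt (toSite r) Lc (KInvStep (d := d) Lc (j + 1)))) Lc (unitS sf sm (SpureRecAt d Lc (toSite r) ((Lc : ℝ) ^ (d + 1)) (-((Lc : ℝ) ^ (d + 1) * (1 / 2) * (Lc : ℝ) ^ (d + 1))) cΛ (j + 1))) (unitM sf sm (M1At d Lc (toSite r) cΛ (j + 1))) 0 (unitM₂ sf sm (M2Of d Lc (mixFFAt (toSite r) Lc) (j + 1)))) μ (toSite r') ν u')
                + cB • B μ (toSite r') ν u') x z (Sum.inl α) (Sum.inl β) else 0)) b₀ a₀ a₀ b₀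
          + (fun μ ν α β : Fin (d + 1) => ∑ r' ∈ box (d + 1) P, ∑' u' : Site (d + 1), ∑' x : Site (d + 1), ∑' z : Site (d + 1),
            (if toSite r' μ % (P : ℤ) = (P : ℤ) - 1 ∧ u' ν % (P : ℤ) = (P : ℤ) - 1 ∧ x α % (P : ℤ) = (P : ℤ) - 1 ∧ z β % (P : ℤ) = (P : ℤ) - 1 then
              (c • mmRead Lc (K3OfK (unitK sf sm (coDressKBmAt (toSite r) Lc (KInvStep (d := d) Lc (j + 1)))) Lc (unitS sf sm (SpureRecAt d Lc (toSite r) ((Lc : ℝ) ^ (d + 1)) (-((Lc : ℝ) ^ (d + 1) * (1 / 2) * (Lc : ℝ) ^ (d + 1))) cΛ (j + 1))) (unitM sf sm (M1At d Lc (toSite r) cΛ (j + 1)))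
                  (W2SymOfK (unitK sf sm (coDressKBmAt (toSite r) Lc (KInvStep (d := d) Lc (j + 1)))) Lc (unitS sf sm (SpureRecAt d Lc (toSite r) ((Lc : ℝ) ^ (d + 1)) (-((Lc : ℝ) ^ (d + 1) * (1 / 2) * (Lc : ℝ) ^ (d + 1))) cΛ (j + 1))) (unitM sf sm (M1At d Lc (toSite r) cΛ (j + 1))) 0 (unitM₂ sf sm (M2Of d Lc (mixFFAt (toSite r) Lc) (j + 1)))) μ (toSite r') ν u')
                + cB • B μ (toSite r') ν u') x z (Sum.inl α) (Sum.inl β) else 0)) a₀ b₀ a₀ b₀)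
        + (((fun μ ν α β : Fin (d + 1) => ∑ r' ∈ box (d + 1) P, ∑' u' : Site (d + 1), ∑' x : Site (d + 1), ∑' z : Site (d + 1),
            (if toSite r' μ % (P : ℤ) = (P : ℤ) - 1 ∧ u' ν % (P : ℤ) = (P : ℤ) - 1 ∧ x α % (P : ℤ) = (P : ℤ) - 1 ∧ z β % (P : ℤ) = (P : ℤ) - 1 then
              (c • mmRead Lc (K3OfK (unitK sf sm (coDressKBmAt (toSite r) Lc (KInvStep (d := d) Lc (j + 1)))) Lc (unitS sf sm (SpureRecAt d Lc (toSite r) ((Lc : ℝ) ^ (d + 1)) (-((Lc : ℝ) ^ (d + 1) * (1 / 2) * (Lc : ℝ) ^ (d + 1))) cΛ (j + 1))) (unitM sf sm (M1At d Lc (toSite r) cΛ (j + 1)))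
                  (W2SymOfK (unitK sf sm (coDressKBmAt (toSite r) Lc (KInvStep (d := d) Lc (j + 1)))) Lc (unitS sf sm (SpureRecAt d Lc (toSite r) ((Lc : ℝ) ^ (d + 1)) (-((Lc : ℝ) ^ (d + 1) * (1 / 2) * (Lc : ℝ) ^ (d + 1))) cΛ (j + 1))) (unitM sf sm (M1At d Lc (toSite r) cΛ (j + 1))) 0 (unitM₂ sf sm (M2Of d Lc (mixFFAt (toSite r) Lc) (j + 1)))) μ (toSite r') ν u')
                + cB • B μ (toSite r') ν u') x z (Sum.inl α) (Sum.inl β) else 0)) a₀ b₀ b₀ a₀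
          + (fun μ ν α β : Fin (d + 1) => ∑ r' ∈ box (d + 1) P, ∑' u' : Site (d + 1), ∑' x : Site (d + 1), ∑' z : Site (d + 1),
            (if toSite r' μ % (P : ℤ) = (P : ℤ) - 1 ∧ u' ν % (P : ℤ) = (P : ℤ) - 1 ∧ x α % (P : ℤ) = (P : ℤ) - 1 ∧ z β % (P : ℤ) = (P : ℤ) - 1 then
              (c • mmRead Lc (K3OfK (unitK sf sm (coDressKBmAt (toSite r) Lc (KInvStep (d := d) Lc (j + 1)))) Lc (unitS sf sm (SpureRecAt d Lc (toSite r) ((Lc : ℝ) ^ (d + 1)) (-((Lc : ℝ) ^ (d + 1) * (1 / 2) * (Lc : ℝ) ^ (d + 1))) cΛ (j + 1))) (unitM sf sm (M1At d Lc (toSite r) cΛ (j + 1)))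
                  (W2SymOfK (unitK sf sm (coDressKBmAt (toSite r) Lc (KInvStep (d := d) Lc (j + 1)))) Lc (unitS sf sm (SpureRecAt d Lc (toSite r) ((Lc : ℝ) ^ (d + 1)) (-((Lc : ℝ) ^ (d + 1) * (1 / 2) * (Lc : ℝ) ^ (d + 1))) cΛ (j + 1))) (unitM sf sm (M1At d Lc (toSite r) cΛ (j + 1))) 0 (unitM₂ sf sm (M2Of d Lc (mixFFAt (toSite r) Lc) (j + 1)))) μ (toSite r') ν u')
                + cB • B μ (toSite r') ν u') x z (Sum.inl α) (Sum.inl β) else 0)) b₀ a₀ b₀ a₀)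
        + ((fun μ ν α β : Fin (d + 1) => ∑ r' ∈ box (d + 1) P, ∑' u' : Site (d + 1), ∑' x : Site (d + 1), ∑' z : Site (d + 1),
            (if toSite r' μ % (P : ℤ) = (P : ℤ) - 1 ∧ u' ν % (P : ℤ) = (P : ℤ) - 1 ∧ x α % (P : ℤ) = (P : ℤ) - 1 ∧ z β % (P : ℤ) = (P : ℤ) - 1 then
              (c • mmRead Lc (K3OfK (unitK sf sm (coDressKBmAt (toSite r) Lc (KInvStep (d := d) Lc (j + 1)))) Lc (unitS sf sm (SpureRecAt d Lc (toSite r) ((Lc : ℝ) ^ (d + 1)) (-((Lc : ℝ) ^ (d + 1) * (1 / 2) * (Lc : ℝ) ^ (d + 1))) cΛ (j + 1))) (unitM sf sm (M1At d Lc (toSite r) cΛ (j + 1)))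
                  (W2SymOfK (unitK sf sm (coDressKBmAt (toSite r) Lc (KInvStep (d := d) Lc (j + 1)))) Lc (unitS sf sm (SpureRecAt d Lc (toSite r) ((Lc : ℝ) ^ (d + 1)) (-((Lc : ℝ) ^ (d + 1) * (1 / 2) * (Lc : ℝ) ^ (d + 1))) cΛ (j + 1))) (unitM sf sm (M1At d Lc (toSite r) cΛ (j + 1))) 0 (unitM₂ sf sm (M2Of d Lc (mixFFAt (toSite r) Lc) (j + 1)))) μ (toSite r') ν u')
                + cB • B μ (toSite r') ν u') x z (Sum.inl α) (Sum.inl β) else 0)) b₀ a₀ b₀ a₀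
          + (fun μ ν α β : Fin (d + 1) => ∑ r' ∈ box (d + 1) P, ∑' u' : Site (d + 1), ∑' x : Site (d + 1), ∑' z : Site (d + 1),
            (if toSite r' μ % (P : ℤ) = (P : ℤ) - 1 ∧ u' ν % (P : ℤ) = (P : ℤ) - 1 ∧ x α % (P : ℤ) = (P : ℤ) - 1 ∧ z β % (P : ℤ) = (P : ℤ) - 1 then
              (c • mmRead Lc (K3OfK (unitK sf sm (coDressKBmAt (toSite r) Lc (KInvStep (d := d) Lc (j + 1)))) Lc (unitS sf sm (SpureRecAt d Lc (toSite r) ((Lc : ℝ) ^ (d + 1)) (-((Lc : ℝ) ^ (d + 1) * (1 / 2) * (Lc : ℝ) ^ (d + 1))) cΛ (j + 1))) (unitM sf sm (M1At d Lc (toSite r) cΛ (j + 1)))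
                  (W2SymOfK (unitK sf sm (coDressKBmAt (toSite r) Lc (KInvStep (d := d) Lc (j + 1)))) Lc (unitS sf sm (SpureRecAt d Lc (toSite r) ((Lc : ℝ) ^ (d + 1)) (-((Lc : ℝ) ^ (d + 1) * (1 / 2) * (Lc : ℝ) ^ (d + 1))) cΛ (j + 1))) (unitM sf sm (M1At d Lc (toSite r) cΛ (j + 1))) 0 (unitM₂ sf sm (M2Of d Lc (mixFFAt (toSite r) Lc) (j + 1)))) μ (toSite r') ν u')
                + cB • B μ (toSite r') ν u') x z (Sum.inl α) (Sum.inl β) else 0)) a₀ b₀ b₀ a₀))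
          = 4 * ((c * -(((sf * sm) * (stepScale d Lc (j + 1) * (Lc : ℝ) ^ (d + 1))⁻¹) * ((sf * sm) * (stepScale d Lc (j + 1) * (Lc : ℝ) ^ (d + 1))⁻¹))) * (((sf * sm) * (stepScale d Lc (j + 1) * (Lc : ℝ) ^ (d + 1))⁻¹) * ((sf * sm) * (stepScale d Lc (j + 1) * (Lc : ℝ) ^ (d + 1))⁻¹))) *
            ((((sf * sm)⁻¹ * (sf⁻¹ * sf⁻¹) * ((Lc : ℝ) ^ (d + 1) * wE d Lc (j + 1))) * ((sf * sm)⁻¹ * (sf⁻¹ * sf⁻¹) * ((Lc : ℝ) ^ (d + 1) * wE d Lc (j + 1)))) *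
      ((-(1 / 2 : ℝ)) * (1 / 2 : ℝ) * ((sf * sf) *
        ((wVH d Lc (j + 1))⁻¹ *
            ∑ x ∈ box (d + 1) (Lc * P), ∑ b : Fin (d + 1),
              ((if b = b₀ then ((((Lc * P : ℕ) : ℝ))⁻¹ * (((Lc * P : ℕ) : ℝ))⁻¹) * ((((toSite x a₀ % ((Lc * P : ℕ) : ℤ) : ℤ) : ℝ) - ((((Lc * P : ℕ) : ℝ)) - 1) / 2)) else 0)
                + (if b = a₀ then (-(((Lc * P : ℕ) : ℝ))⁻¹ * ((((toSite x b₀ % ((Lc * P : ℕ) : ℤ) : ℤ) : ℝ) - ((((Lc * P : ℕ) : ℝ)) - 1) / 2))) *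
                    (if toSite x a₀ % ((Lc * P : ℕ) : ℤ) = ((Lc * P : ℕ) : ℤ) - 1 then (1 : ℝ) else 0) else 0)) *
              ∑' s : Site (d + 1), ∑ b' : Fin (d + 1), E2 d Lc (j + 1) (toSite x) s (Sum.inl b) (Sum.inl b') *
                ((if b' = a₀ then ((((Lc * P : ℕ) : ℝ))⁻¹ * (((Lc * P : ℕ) : ℝ))⁻¹) * ((((s b₀ % ((Lc * P : ℕ) : ℤ) : ℤ) : ℝ) - ((((Lc * P : ℕ) : ℝ)) - 1) / 2)) else 0)
                  + (if b' = b₀ then (-(((Lc * P : ℕ) : ℝ))⁻¹ * ((((s a₀ % ((Lc * P : ℕ) : ℤ) : ℤ) : ℝ) - ((((Lc * P : ℕ) : ℝ)) - 1) / 2))) *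
                      (if s b₀ % ((Lc * P : ℕ) : ℤ) = ((Lc * P : ℕ) : ℤ) - 1 then (1 : ℝ) else 0) else 0)) -
          (wVH d Lc (j + 1))⁻¹ * (((Lc : ℝ) ^ (d + 1) * (Lc : ℝ) ^ (d + 1)) *
            ∑ y ∈ box (d + 1) P, ∑ a : Fin (d + 1),
              ((if a = b₀ then (((P : ℝ))⁻¹ * ((P : ℝ))⁻¹) * ((((toSite y a₀ % (P : ℤ)) : ℤ) : ℝ) - ((P : ℝ) - 1) / 2) else 0)
                + (if a = a₀ then (-((P : ℝ))⁻¹ * ((((toSite y b₀ % (P : ℤ)) : ℤ) : ℝ) - ((P : ℝ) - 1) / 2)) *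
                    (if toSite y a₀ % (P : ℤ) = (P : ℤ) - 1 then (1 : ℝ) else 0) else 0)) *
              ∑' s : Site (d + 1), ∑ b' : Fin (d + 1), E2 d Lc (j + 2) (toSite y) s (Sum.inl a) (Sum.inl b') *
                ((if b' = a₀ then (((P : ℝ))⁻¹ * ((P : ℝ))⁻¹) * ((((s b₀ % (P : ℤ)) : ℤ) : ℝ) - ((P : ℝ) - 1) / 2) else 0)
                  + (if b' = b₀ then (-((P : ℝ))⁻¹ * ((((s a₀ % (P : ℤ)) : ℤ) : ℝ) - ((P : ℝ) - 1) / 2)) *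
                      (if s b₀ % (P : ℤ) = (P : ℤ) - 1 then (1 : ℝ) else 0) else 0))))))
            + (((sf * sm)⁻¹ * (sf⁻¹ * sf⁻¹) * ((Lc : ℝ) ^ (d + 1) * wE d Lc (j + 1))) * ((sf * sm)⁻¹ * (sf⁻¹ * sf⁻¹) * ((Lc : ℝ) ^ (d + 1) * wE d Lc (j + 1)))) *
      ((-(1 / 2 : ℝ)) * (1 / 2 : ℝ) * ((sf * sf) *
        ((wVH d Lc (j + 1))⁻¹ *
            ∑ x ∈ box (d + 1) (Lc * P), ∑ b : Fin (d + 1),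
              ((if b = a₀ then ((((Lc * P : ℕ) : ℝ))⁻¹ * (((Lc * P : ℕ) : ℝ))⁻¹) * ((((toSite x b₀ % ((Lc * P : ℕ) : ℤ) : ℤ) : ℝ) - ((((Lc * P : ℕ) : ℝ)) - 1) / 2)) else 0)
                + (if b = b₀ then (-(((Lc * P : ℕ) : ℝ))⁻¹ * ((((toSite x a₀ % ((Lc * P : ℕ) : ℤ) : ℤ) : ℝ) - ((((Lc * P : ℕ) : ℝ)) - 1) / 2))) *
                    (if toSite x b₀ % ((Lc * P : ℕ) : ℤ) = ((Lc * P : ℕ) : ℤ) - 1 then (1 : ℝ) else 0) else 0)) *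
              ∑' s : Site (d + 1), ∑ b' : Fin (d + 1), E2 d Lc (j + 1) (toSite x) s (Sum.inl b) (Sum.inl b') *
                ((if b' = b₀ then ((((Lc * P : ℕ) : ℝ))⁻¹ * (((Lc * P : ℕ) : ℝ))⁻¹) * ((((s a₀ % ((Lc * P : ℕ) : ℤ) : ℤ) : ℝ) - ((((Lc * P : ℕ) : ℝ)) - 1) / 2)) else 0)
                  + (if b' = a₀ then (-(((Lc * P : ℕ) : ℝ))⁻¹ * ((((s b₀ % ((Lc * P : ℕ) : ℤ) : ℤ) : ℝ) - ((((Lc * P : ℕ) : ℝ)) - 1) / 2))) *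
                      (if s a₀ % ((Lc * P : ℕ) : ℤ) = ((Lc * P : ℕ) : ℤ) - 1 then (1 : ℝ) else 0) else 0)) -
          (wVH d Lc (j + 1))⁻¹ * (((Lc : ℝ) ^ (d + 1) * (Lc : ℝ) ^ (d + 1)) *
            ∑ y ∈ box (d + 1) P, ∑ a : Fin (d + 1),
              ((if a = a₀ then (((P : ℝ))⁻¹ * ((P : ℝ))⁻¹) * ((((toSite y b₀ % (P : ℤ)) : ℤ) : ℝ) - ((P : ℝ) - 1) / 2) else 0)
                + (if a = b₀ then (-((P : ℝ))⁻¹ * ((((toSite y a₀ % (P : ℤ)) : ℤ) : ℝ) - ((P : ℝ) - 1) / 2)) *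
                    (if toSite y b₀ % (P : ℤ) = (P : ℤ) - 1 then (1 : ℝ) else 0) else 0)) *
              ∑' s : Site (d + 1), ∑ b' : Fin (d + 1), E2 d Lc (j + 2) (toSite y) s (Sum.inl a) (Sum.inl b') *
                ((if b' = b₀ then (((P : ℝ))⁻¹ * ((P : ℝ))⁻¹) * ((((s a₀ % (P : ℤ)) : ℤ) : ℝ) - ((P : ℝ) - 1) / 2) else 0)
                  + (if b' = a₀ then (-((P : ℝ))⁻¹ * ((((s b₀ % (P : ℤ)) : ℤ) : ℝ) - ((P : ℝ) - 1) / 2)) *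
                      (if s a₀ % (P : ℤ) = (P : ℤ) - 1 then (1 : ℝ) else 0) else 0))))))) := by
  obtain ⟨C₂, δ₂, hδ₂, hM₂⟩ := exists_locStencilFM_unitM₂_M2Of hLc hr sf sm (j + 1)
  exact crossed_faceRead_dressedStep_deep hLc hr hP sf sm cΛ j (vertexFamily_unitM_M1At hLc hr sf sm cΛ (j + 1)) one_pos
    (fun ρ' w t => unitM_M1At_translate (Lc := Lc) (r := r) sf sm cΛ (j + 1) ρ' w t)
    (fun κ u => trK_unitS_SpureRecAt hLc hr sf sm ((Lc : ℝ) ^ (d + 1)) (-((Lc : ℝ) ^ (d + 1) * (1 / 2) * (Lc : ℝ) ^ (d + 1))) cΛ (j + 1) κ u)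
    (fun ρ' w => trK_unitM_M1At (Lc := Lc) (r := r) sf sm cΛ (j + 1) ρ' w) hM₂ hδ₂
    (fun κ u ρ' w t => unitM₂_M2Of_translate (Lc := Lc) (r := r) sf sm (j + 1) κ u ρ' w t) hBff c cB hab

end Summit.QuantumFields.BalabanUV.Beta.GAN24.FaceReadCrossedValueRootDeep

end
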